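import Summits.CriticalPhenomena.SAWScalingLimit.Theorems.MassRatio.Negative.Tools

/-!
# Crux `MassRatio` (stmt-CriticalPhenomena-8550) — load-bearing hypotheses, part 5: the rows family `ΛR` (rectangle of rows `mRow..MRow`, positions `-PPos..PPos`), root `aE`, target `bE`; simple connectivity, connectedness, boundary edges, a SAW, inside `D₀`

Negative knowledge on the crux `MassRatio` (stmt-CriticalPhenomena-8550, route SAWDefectDecoherence r3),
written by the standing disprover (cdisprove, cycles 1–4). The series `MassRatio/Negative/*` does NOT
refute the crux (verdict: RESISTS — it is a pure exponent bet, predicted ratio `δ^{-25/48}` against the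
cut `δ^{-3/4}`); it proves which hypotheses of the crux are LOAD-BEARING (rows clause, `0 < ρ`,
`δ·mid(b_δ) → b`, exhaustion of compacts: each deleted ⇒ FALSE, by explicit admissible families in the
rectangle `D₀ = (-2,2)×(-1,1)` whose boundary mass at the target edge is starved EXACTLY by a bare
corridor), that the hypothesis frame is satisfiable (`massRatio_frame_nonvacuous`), and that the
`Nonempty`-SAW clause is implied by the others. Mechanism throughout: on a bare root-attached corridor
the self-avoiding walk is unique, so `|Z| = x_c^{length}` exactly, while a staircase walk certifies
`|Z(e₀)| ≥ x_c^{2 iK + 1}` at a mid-edge `e₀` of the compact `Kbox`; `x_c < 3/5` and Bernoulli finish.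
-/

namespace Summit.CriticalPhenomena.SAWScalingLimit.Theorems.MassRatio.Negative

open Literature.Probability.LatticeModels Literature.Probability.RandomPlanarGeometry.SAW
open Literature.Probability.RandomPlanarGeometry
open Summit.CriticalPhenomena.SAWScalingLimit.Theses.SAWDefectDecoherence

/-! ## §F. The rows family `ΛR`: the hypothesis frame of the crux is satisfiable -/

/-- lattice rectangle `rows [r₁, r₂] × positions [p₁, p₂]` [folklore] -/
noncomputable def Rect (r₁ r₂ p₁ p₂ : ℤ) : Finset HexVertex :=
  ((Finset.Icc r₁ r₂) ×ˢ (Finset.Icc p₁ p₂)).image fun rp => bv rp.1 rp.2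

/-- `mem_Rect`: rows-family (`ΛR`) lemma (MassRatio negative series). [folklore] -/
theorem mem_Rect {r₁ r₂ p₁ p₂ : ℤ} {v : HexVertex} :
    v ∈ Rect r₁ r₂ p₁ p₂ ↔ r₁ ≤ row v ∧ row v ≤ r₂ ∧ p₁ ≤ pos v ∧ pos v ≤ p₂ := by
  simp only [Rect, Finset.mem_image, Finset.mem_product, Finset.mem_Icc, Prod.exists]
  constructor
  · rintro ⟨r, p, ⟨⟨h1, h2⟩, h3, h4⟩, rfl⟩
    simp only [row_bv, pos_bv]; exact ⟨h1, h2, h3, h4⟩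
  · rintro ⟨h1, h2, h3, h4⟩
    exact ⟨row v, pos v, ⟨⟨h1, h2⟩, h3, h4⟩, bv_row_pos v⟩

/-- `bv_mem_Rect`: rows-family (`ΛR`) lemma (MassRatio negative series). [folklore] -/
theorem bv_mem_Rect {r₁ r₂ p₁ p₂ r p : ℤ} :
    bv r p ∈ Rect r₁ r₂ p₁ p₂ ↔ r₁ ≤ r ∧ r ≤ r₂ ∧ p₁ ≤ p ∧ p ≤ p₂ := by
  rw [mem_Rect, row_bv, pos_bv]

/-- **The rows family**: all vertices with row in `[m_δ, M_δ]` and position in `[-P_δ, P_δ]`. [folklore] -/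
noncomputable def ΛR (δ : ℝ) : Finset HexVertex := Rect (mRow δ) (MRow δ) (-PPos δ) (PPos δ)

/-- the root mid-edge `a_δ`: the vertical boundary mid-edge below `(m_δ, pA_δ)` [folklore] -/
noncomputable def aE (δ : ℝ) : Sym2 HexVertex := s(bv (mRow δ - 1) (pA δ), bv (mRow δ) (pA δ))

/-- the marked boundary mid-edge `b_δ` of the rows family: the vertical mid-edge below
`(m_δ, pB_δ)` [folklore] -/
noncomputable def bE (δ : ℝ) : Sym2 HexVertex := s(bv (mRow δ) (pB δ), bv (mRow δ - 1) (pB δ))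

section RowsFamily

variable {δ : ℝ}

/-- `bv_mem_ΛR`: rows-family (`ΛR`) lemma (MassRatio negative series). [folklore] -/
theorem bv_mem_ΛR {r p : ℤ} :
    bv r p ∈ ΛR δ ↔ mRow δ ≤ r ∧ r ≤ MRow δ ∧ -PPos δ ≤ p ∧ p ≤ PPos δ := bv_mem_Rect

/-- `bv_mem_compl_ΛR`: rows-family (`ΛR`) lemma (MassRatio negative series). [folklore] -/
theorem bv_mem_compl_ΛR {r p : ℤ} (h : ¬ (mRow δ ≤ r ∧ r ≤ MRow δ ∧ -PPos δ ≤ p ∧ p ≤ PPos δ)) :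
    bv r p ∈ ((↑(ΛR δ) : Set HexVertex))ᶜ := by
  rw [Set.mem_compl_iff, Finset.mem_coe, bv_mem_ΛR]; exact h

/-- `adj_aE`: rows-family (`ΛR`) lemma (MassRatio negative series). [folklore] -/
theorem adj_aE (δ : ℝ) : hexGraph.Adj (bv (mRow δ - 1) (pA δ)) (bv (mRow δ) (pA δ)) := by
  rw [adj_bv_iff]; right; right
  have := pA_mod δ
  exact ⟨rfl, by ring, by omega⟩

/-- `adj_bE`: rows-family (`ΛR`) lemma (MassRatio negative series). [folklore] -/
theorem adj_bE (δ : ℝ) : hexGraph.Adj (bv (mRow δ - 1) (pB δ)) (bv (mRow δ) (pB δ)) := by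
  rw [adj_bv_iff]; right; right
  have := pB_mod δ
  exact ⟨rfl, by ring, by omega⟩

/-- Every vertex off `ΛR` is linked, off `ΛR`, to the anchor `(m-1, -P-3)`: the complement is
connected. [folklore] -/
theorem linked_compl_ΛR (hδ : 0 < δ) (hδ1 : δ ≤ 1 / 100) {v : HexVertex} (hv : v ∉ ΛR δ) :
    Linked ((↑(ΛR δ) : Set HexVertex))ᶜ v (bv (mRow δ - 1) (-PPos δ - 3)) := by
  obtain ⟨-, hM0, hm10, -, -, -, -, hP100, -⟩ := params hδ hδ1
  set m := mRow δ with hm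
  set M := MRow δ with hM
  set P := PPos δ with hP
  have hv' : v = bv (row v) (pos v) := (bv_row_pos v).symm
  set r := row v with hr
  set p := pos v with hp
  rw [hv'] at hv ⊢
  rw [bv_mem_ΛR] at hv
  have nm : ∀ r' p' : ℤ, ¬ (m ≤ r' ∧ r' ≤ M ∧ -P ≤ p' ∧ p' ≤ P) →
      bv r' p' ∈ ((↑(ΛR δ) : Set HexVertex))ᶜ := fun r' p' h => bv_mem_compl_ΛR h
  -- vertical band on the left
  have bandL : ∀ r' : ℤ, Linked ((↑(ΛR δ) : Set HexVertex))ᶜ (bv r' (-P - 3)) (bv (m - 1) (-P - 3)) := by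
    intro r'
    rcases le_or_gt r' (m - 1) with h | h
    · exact (linked_band (-P - 3) r' (m - 1) h fun r'' _ _ =>
        ⟨nm _ _ (by omega), by have := nm r'' (-P - 3 + 1) (by omega); exact this⟩).symm
    · exact linked_band (-P - 3) (m - 1) r' h.le fun r'' _ _ =>
        ⟨nm _ _ (by omega), by have := nm r'' (-P - 3 + 1) (by omega); exact this⟩
  by_cases hrow : m ≤ r ∧ r ≤ M
  · -- then the position is out of range
    have hpout : p < -P ∨ P < p := by omega
    rcases hpout with hpl | hpr
    · -- left: run to `-P-3`, then the band
      have step1 : Linked ((↑(ΛR δ) : Set HexVertex))ᶜ (bv r p) (bv r (-P - 3)) := by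
        rcases le_or_gt p (-P - 3) with h | h
        · exact linked_run' r p (-P - 3) h fun t _ _ => nm _ _ (by omega)
        · exact (linked_run' r (-P - 3) p h.le fun t _ _ => nm _ _ (by omega)).symm
      exact step1.trans (bandL r)
    · -- right: run to `P+2`, band down, then along the free row `m-1`
      have step1 : Linked ((↑(ΛR δ) : Set HexVertex))ᶜ (bv r p) (bv r (P + 2)) := by
        rcases le_or_gt p (P + 2) with h | h
        · exact linked_run' r p (P + 2) h fun t _ _ => nm _ _ (by omega)
        · exact (linked_run' r (P + 2) p h.le fun t _ _ => nm _ _ (by omega)).symm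
      have step2 : Linked ((↑(ΛR δ) : Set HexVertex))ᶜ (bv r (P + 2)) (bv (m - 1) (P + 2)) :=
        linked_band (P + 2) (m - 1) r (by omega) fun r'' _ _ =>
          ⟨nm _ _ (by omega), by have := nm r'' (P + 2 + 1) (by omega); exact this⟩
      have step3 : Linked ((↑(ΛR δ) : Set HexVertex))ᶜ (bv (m - 1) (P + 2)) (bv (m - 1) (-P - 3)) :=
        (linked_run' (m - 1) (-P - 3) (P + 2) (by omega) fun t _ _ => nm _ _ (by omega)).symm
      exact (step1.trans step2).trans step3
  · -- free row: run to `-P-3`, then the band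
    have step1 : Linked ((↑(ΛR δ) : Set HexVertex))ᶜ (bv r p) (bv r (-P - 3)) := by
      rcases le_or_gt p (-P - 3) with h | h
      · exact linked_run' r p (-P - 3) h fun t _ _ => nm _ _ (by omega)
      · exact (linked_run' r (-P - 3) p h.le fun t _ _ => nm _ _ (by omega)).symm
    exact step1.trans (bandL r)

/-- `simplyConnected_ΛR`: rows-family (`ΛR`) lemma (MassRatio negative series). [folklore] -/
theorem simplyConnected_ΛR (hδ : 0 < δ) (hδ1 : δ ≤ 1 / 100) : hexDomainSimplyConnected (ΛR δ) :=
  preconnected_of_linked fun _ hu _ hv =>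
    (linked_compl_ΛR hδ hδ1 (fun h => hu h)).trans (linked_compl_ΛR hδ hδ1 (fun h => hv h)).symm

/-- `ΛR` is connected: every vertex is linked inside `ΛR` to `(M, 0)`. [folklore] -/
theorem linked_ΛR (hδ : 0 < δ) (hδ1 : δ ≤ 1 / 100) {v : HexVertex} (hv : v ∈ ΛR δ) :
    Linked (↑(ΛR δ) : Set HexVertex) v (bv (MRow δ) 0) := by
  obtain ⟨-, hM0, hm10, -, -, -, -, hP100, -⟩ := params hδ hδ1
  have hv' : v = bv (row v) (pos v) := (bv_row_pos v).symm
  set r := row v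
  set p := pos v
  rw [hv'] at hv ⊢
  rw [bv_mem_ΛR] at hv
  have mm : ∀ r' p' : ℤ, (mRow δ ≤ r' ∧ r' ≤ MRow δ ∧ -PPos δ ≤ p' ∧ p' ≤ PPos δ) →
      bv r' p' ∈ (↑(ΛR δ) : Set HexVertex) := fun r' p' h => by
    rw [Finset.mem_coe, bv_mem_ΛR]; exact h
  have step1 : Linked (↑(ΛR δ) : Set HexVertex) (bv r p) (bv r 0) := by
    rcases le_or_gt p 0 with h | h
    · exact linked_run' r p 0 h fun t _ _ => mm _ _ (by omega)
    · exact (linked_run' r 0 p h.le fun t _ _ => mm _ _ (by omega)).symm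
  have step2 : Linked (↑(ΛR δ) : Set HexVertex) (bv r 0) (bv (MRow δ) 0) :=
    (linked_band 0 r (MRow δ) hv.2.1 fun r'' h1 h2 => ⟨mm _ _ (by omega), mm _ _ (by omega)⟩).symm
  exact step1.trans step2

/-- `preconnected_ΛR`: rows-family (`ΛR`) lemma (MassRatio negative series). [folklore] -/
theorem preconnected_ΛR (hδ : 0 < δ) (hδ1 : δ ≤ 1 / 100) :
    (hexGraph.induce ((ΛR δ : Finset HexVertex) : Set HexVertex)).Preconnected :=
  preconnected_of_linked fun _ hu _ hv =>
    (linked_ΛR hδ hδ1 hu).trans (linked_ΛR hδ hδ1 hv).symm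

/-- `aE_mem_boundary`: rows-family (`ΛR`) lemma (MassRatio negative series). [folklore] -/
theorem aE_mem_boundary (hδ : 0 < δ) (hδ1 : δ ≤ 1 / 100) : aE δ ∈ hexDomainBoundary (ΛR δ) := by
  obtain ⟨-, hM0, hm10, hPa, hpa, -, -, hP100, -⟩ := params hδ hδ1
  refine ⟨(SimpleGraph.mem_edgeSet _).2 (adj_aE δ), bv (mRow δ - 1) (pA δ), bv (mRow δ) (pA δ),
    rfl, ?_, ?_⟩
  · rw [bv_mem_ΛR]; omega
  · rw [bv_mem_ΛR]; omega

/-- `bE_mem_boundary`: rows-family (`ΛR`) lemma (MassRatio negative series). [folklore] -/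
theorem bE_mem_boundary (hδ : 0 < δ) (hδ1 : δ ≤ 1 / 100) : bE δ ∈ hexDomainBoundary (ΛR δ) := by
  obtain ⟨-, hM0, hm10, -, -, hpb, hPb, hP100, -⟩ := params hδ hδ1
  refine ⟨(SimpleGraph.mem_edgeSet _).2 (adj_bE δ).symm, bv (mRow δ - 1) (pB δ), bv (mRow δ) (pB δ),
    Sym2.eq_swap, ?_, ?_⟩
  · rw [bv_mem_ΛR]; omega
  · rw [bv_mem_ΛR]; omega

/-- The straight walk along the bottom row from `a_δ` to `b_δ`. [folklore] -/
theorem nonempty_saw_ΛR (hδ : 0 < δ) (hδ1 : δ ≤ 1 / 100) :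
    Nonempty (HexMidEdgeSAW (ΛR δ) (aE δ) (bE δ)) := by
  obtain ⟨-, hM0, hm10, hPa, hpa, hpb, hPb, hP100, -⟩ := params hδ hδ1
  set L : ℕ := (pB δ - pA δ).toNat with hL
  have hLeq : (L : ℤ) = pB δ - pA δ := by rw [hL]; omega
  set c : ℕ → HexVertex := fun i => bv (mRow δ) (pA δ + i) with hc
  have ha : aE δ = s(bv (mRow δ - 1) (pA δ), c 0) := by simp [aE, hc]
  have hb : bE δ = s(c L, bv (mRow δ - 1) (pB δ)) := by
    simp only [bE, hc, hLeq]; congr 2; ring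
  rw [ha, hb]
  refine ⟨corridorWalk (Λ := ΛR δ) (c := c) (L := L) ?_ ?_ ?_ ?_ ?_ ?_ ?_⟩
  · intro i hi; simp only [hc]; rw [bv_mem_ΛR]; omega
  · intro i j _ _ h; simp only [hc] at h; have := (bv_inj h).2; omega
  · intro i _; simp only [hc]; rw [adj_bv_iff]; left; exact ⟨rfl, Or.inl (by push_cast; ring)⟩
  · simpa [hc] using adj_aE δ
  · rw [bv_mem_ΛR]; omega
  · rw [bv_mem_ΛR]; omega
  · intro h
    simp only [hc] at h
    rcases Sym2.eq_iff.1 h with ⟨h1, -⟩ | ⟨h1, -⟩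
    · have := (bv_inj h1).1; omega
    · have := (bv_inj h1).2; omega

/-- `inside_ΛR`: rows-family (`ΛR`) lemma (MassRatio negative series). [folklore] -/
theorem inside_ΛR (hδ : 0 < δ) (hδ1 : δ ≤ 1 / 100) :
    ∀ v ∈ ΛR δ, (δ : ℂ) * hexCenter v ∈ D₀.carrier := by
  intro v hv
  have hv' := hv
  rw [← bv_row_pos v, bv_mem_ΛR] at hv'
  obtain ⟨h1, h2, h3, h4⟩ := hv'
  rw [mem_D₀_carrier, re_scaled]
  have hg := hgt_pos
  have e1 := mRow_height hδ
  have e2 := MRow_height hδ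
  have e3 := PPos_width hδ
  have e4 := PPos_width' hδ
  have i1 := im_scaled_ge δ hδ.le v
  have i2 := im_scaled_le δ hδ.le v
  have h1' : (mRow δ : ℝ) ≤ row v := by exact_mod_cast h1
  have h2' : (row v : ℝ) ≤ MRow δ := by exact_mod_cast h2
  have h3' : (-PPos δ : ℝ) ≤ pos v := by exact_mod_cast h3
  have h4' : (pos v : ℝ) ≤ PPos δ := by exact_mod_cast h4
  have hp : 0 < δ * hgt := by positivity
  refine ⟨⟨by nlinarith, by nlinarith⟩, ?_, ?_⟩
  · calc (-1 : ℝ) < δ * hgt * ((mRow δ : ℝ) + 1 / 3) := e1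
      _ ≤ δ * hgt * ((row v : ℝ) + 1 / 3) := by nlinarith
      _ ≤ _ := i1
  · calc ((δ : ℂ) * hexCenter v).im ≤ δ * hgt * ((row v : ℝ) + 2 / 3) := i2
      _ ≤ δ * hgt * ((MRow δ : ℝ) + 2 / 3) := by nlinarith
      _ < 1 := e2

end RowsFamily

end Summit.CriticalPhenomena.SAWScalingLimit.Theorems.MassRatio.Negative
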